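import Summits.HubbardSuperconductivity.HubbardSuperconductivity.Theses.RelocationFloor
import HarnessLib

/-!
# Birth skeleton (BC3) for the crux `DWaveChannelSelection` (stmt-HubbardSuperconductivity-17960; piece X₁ of the split of `B1gSignCoherence`, route `RelocationFloor`)

Line "by B1g character class": the sign rule splits into the two character classes of the bond
pair `(e, e')` — `g_d(e) g_d(e') = +1` (parallel / antiparallel bonds: far pair correlations comparable
to the transplant mass are NON-NEGATIVE, the s-and-d-agnostic "pair translation coherence") and
`g_d(e) g_d(e') = -1` (perpendicular bonds: they are NON-POSITIVE — the genuinely `B1g` statement, the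
plaquette sign of a rotated pair; Scalapino–Trugman 1996, Scalapino 1995 §2). `DWaveChannelSelection_of`
assembles them (`g_d² = 1` on unit steps).
-/

noncomputable section

set_option linter.dupNamespace false

namespace Summit.HubbardSuperconductivity.HubbardSuperconductivity.Cruxes.DWaveChannelSelection.Birth

open Matrix Finset
open Literature.Probability.LatticeModels Literature.MathematicalPhysics.QuantumLattice
open Summit.HubbardSuperconductivity.HubbardSuperconductivity.Theses.RelocationFloor

/-- `g_d(e)² = 1` on the four unit steps. [folklore] -/
theorem sq_dWaveFormFactor_eq_one {e : Site 2} (he : e ∈ unitSteps) : dWaveFormFactor e ^ 2 = 1 := by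
  simp only [unitSteps, Finset.mem_insert, Finset.mem_singleton] at he
  rcases he with rfl | rfl | rfl | rfl
  · rw [dWaveFormFactor, if_pos (Or.inl rfl)]; norm_num
  · rw [dWaveFormFactor, if_pos (Or.inr rfl)]; norm_num
  · rw [dWaveFormFactor, if_neg (by decide), if_pos (Or.inl rfl)]; norm_num
  · rw [dWaveFormFactor, if_neg (by decide), if_pos (Or.inr rfl)]; norm_num

/-- STUB A (parallel/antiparallel class, `g g' = +1`): far pair correlations of Bloch ground states
comparable to the transplant mass are non-negative. [difficulty: XL] -/
theorem stub_parallelClassNonneg : ∀ U ∈ Set.Icc (2 : ℝ) 5, ∀ δ ∈ Set.Icc (1 / 5 : ℝ) (3 / 10), ∀ ε : ℝ, 0 < ε → ∃ R L₀ : ℕ, ∀ (L : ℕ) [NeZero L], L₀ ≤ L → Even L → ∀ ψ : Fock (Orb (FermionTorus 2 L)), star ψ ⬝ᵥ ψ = 1 → IsGroundStateInSector (hubbardTorus 2 L 1 U) (2 * ⌊(1 - δ) * (L : ℝ) ^ 2 / 2⌋₊) 0 ψ → (∀ v : TorusSite 2 L, ∃ c : ℂ, (fockTranslate v).val *ᵥ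 ψ = c • ψ) → ∀ r : TorusSite 2 L, R ≤ torusDist r 0 → ∀ e ∈ unitSteps, ∀ e' ∈ unitSteps, dWaveFormFactor e * dWaveFormFactor e' = 1 → let A : TorusSite 2 L → Site 2 → Matrix (Finset (Orb (FermionTorus 2 L))) (Finset (Orb (FermionTorus 2 L))) ℂ := fun x u => annihilation (orb (FermionTorus.ofTorusSite x) 0) * annihilation (orb (FermionTorus.ofTorusSite (x + Torus.proj L u)) 1); let φ : TorusSite 2 L → Fock (Orb (FermionTorus 2 L)) := fun x => ((A x e)ᴴ * A (x + r) e') *ᵥ ψ; 2 * ε * (∑ x : TorusSite 2 L, (star (φ x) ⬝ᵥ φ x).re) ≤ |∑ x : TorusSite 2 L, (star ψ ⬝ᵥ φ x).re| → 0 ≤ ∑ x : TorusSite 2 L, (star ψ ⬝ᵥ φ x).re := by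
  sorry

/-- STUB B (perpendicular class, `g g' = -1`): far pair correlations of Bloch ground states between
perpendicular bonds comparable to the transplant mass are non-positive (the `B1g` plaquette sign).
[difficulty: XL] -/
theorem stub_perpendicularClassNonpos : ∀ U ∈ Set.Icc (2 : ℝ) 5, ∀ δ ∈ Set.Icc (1 / 5 : ℝ) (3 / 10), ∀ ε : ℝ, 0 < ε → ∃ R L₀ : ℕ, ∀ (L : ℕ) [NeZero L], L₀ ≤ L → Even L → ∀ ψ : Fock (Orb (FermionTorus 2 L)), star ψ ⬝ᵥ ψ = 1 → IsGroundStateInSector (hubbardTorus 2 L 1 U) (2 * ⌊(1 - δ) * (L : ℝ) ^ 2 / 2⌋₊) 0 ψ → (∀ v : TorusSite 2 L, ∃ c : ℂ, (fockTranslate v).val *ᵥ ψ = c • ψ) → ∀ r : TorusSite 2 L, R ≤ torusDist r 0 → ∀ e ∈ unitSteps, ∀ e' ∈ unitSteps, dWaveFormFactor e * dWaveFormFactor e' = -1 → let A : TorusSite 2 L → Site 2 → Matrix (Finset (Orb (FermionTorus 2 L))) (Finset (Orb (FermionTorus 2 L))) ℂ := fun x u => annihilation (orb (FermionTorus.ofTorusSite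 x) 0) * annihilation (orb (FermionTorus.ofTorusSite (x + Torus.proj L u)) 1); let φ : TorusSite 2 L → Fock (Orb (FermionTorus 2 L)) := fun x => ((A x e)ᴴ * A (x + r) e') *ᵥ ψ; 2 * ε * (∑ x : TorusSite 2 L, (star (φ x) ⬝ᵥ φ x).re) ≤ |∑ x : TorusSite 2 L, (star ψ ⬝ᵥ φ x).re| → ∑ x : TorusSite 2 L, (star ψ ⬝ᵥ φ x).re ≤ 0 := by
  sorry

/-- Composition: the two character classes give `DWaveChannelSelection` (by name). [folklore] -/
theorem DWaveChannelSelection_of : (∀ U ∈ Set.Icc (2 : ℝ) 5, ∀ δ ∈ Set.Icc (1 / 5 : ℝ) (3 / 10), ∀ ε : ℝ, 0 < ε → ∃ R L₀ : ℕ, ∀ (L : ℕ) [NeZero L], L₀ ≤ L → Even L → ∀ ψ : Fock (Orb (FermionTorus 2 L)), star ψ ⬝ᵥ ψ = 1 → IsGroundStateInSector (hubbardTorus 2 L 1 U) (2 * ⌊(1 - δ) * (L : ℝ) ^ 2 / 2⌋₊) 0 ψ → (∀ v : TorusSite 2 L, ∃ c : ℂ, (fockTranslate v).val *ᵥ ψ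 = c • ψ) → ∀ r : TorusSite 2 L, R ≤ torusDist r 0 → ∀ e ∈ unitSteps, ∀ e' ∈ unitSteps, dWaveFormFactor e * dWaveFormFactor e' = 1 → let A : TorusSite 2 L → Site 2 → Matrix (Finset (Orb (FermionTorus 2 L))) (Finset (Orb (FermionTorus 2 L))) ℂ := fun x u => annihilation (orb (FermionTorus.ofTorusSite x) 0) * annihilation (orb (FermionTorus.ofTorusSite (x + Torus.proj L u)) 1); let φ : TorusSite 2 L → Fock (Orb (FermionTorus 2 L)) := fun x => ((A x e)ᴴ * A (x + r) e') *ᵥ ψ; 2 * ε * (∑ x : TorusSite 2 L, (star (φ x) ⬝ᵥ φ x).re) ≤ |∑ x : TorusSite 2 L, (star ψ ⬝ᵥ φ x).re| → 0 ≤ ∑ x : TorusSite 2 L, (star ψ ⬝ᵥ φ x).re) → (∀ U ∈ Set.Icc (2 : ℝ) 5, ∀ δ ∈ Set.Icc (1 / 5 : ℝ) (3 / 10), ∀ ε : ℝ, 0 < ε → ∃ R L₀ : ℕ, ∀ (L : ℕ) [NeZero L], L₀ ≤ L → Even L → ∀ ψ : Fock (Orb (FermionTorus 2 L)), star ψ ⬝ᵥ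 ψ = 1 → IsGroundStateInSector (hubbardTorus 2 L 1 U) (2 * ⌊(1 - δ) * (L : ℝ) ^ 2 / 2⌋₊) 0 ψ → (∀ v : TorusSite 2 L, ∃ c : ℂ, (fockTranslate v).val *ᵥ ψ = c • ψ) → ∀ r : TorusSite 2 L, R ≤ torusDist r 0 → ∀ e ∈ unitSteps, ∀ e' ∈ unitSteps, dWaveFormFactor e * dWaveFormFactor e' = -1 → let A : TorusSite 2 L → Site 2 → Matrix (Finset (Orb (FermionTorus 2 L))) (Finset (Orb (FermionTorus 2 L))) ℂ := fun x u => annihilation (orb (FermionTorus.ofTorusSite x) 0) * annihilation (orb (FermionTorus.ofTorusSite (x + Torus.proj L u)) 1); let φ : TorusSite 2 L → Fock (Orb (FermionTorus 2 L)) := fun x => ((A x e)ᴴ * A (x + r) e') *ᵥ ψ; 2 * ε * (∑ x : TorusSite 2 L, (star (φ x) ⬝ᵥ φ x).re) ≤ |∑ x : TorusSite 2 L, (star ψ ⬝ᵥ φ x).re| → ∑ x : TorusSite 2 L, (star ψ ⬝ᵥ φ x).re ≤ 0) → (∀ U ∈ Set.Icc (2 : ℝ) 5, ∀ δ ∈ Set.Icc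 (1 / 5 : ℝ) (3 / 10), ∀ ε : ℝ, 0 < ε → ∃ R L₀ : ℕ, ∀ (L : ℕ) [NeZero L], L₀ ≤ L → Even L → ∀ ψ : Fock (Orb (FermionTorus 2 L)), star ψ ⬝ᵥ ψ = 1 → IsGroundStateInSector (hubbardTorus 2 L 1 U) (2 * ⌊(1 - δ) * (L : ℝ) ^ 2 / 2⌋₊) 0 ψ → (∀ v : TorusSite 2 L, ∃ c : ℂ, (fockTranslate v).val *ᵥ ψ = c • ψ) → ∀ r : TorusSite 2 L, R ≤ torusDist r 0 → ∀ e ∈ unitSteps, ∀ e' ∈ unitSteps, let A : TorusSite 2 L → Site 2 → Matrix (Finset (Orb (FermionTorus 2 L))) (Finset (Orb (FermionTorus 2 L))) ℂ := fun x u => annihilation (orb (FermionTorus.ofTorusSite x) 0) * annihilation (orb (FermionTorus.ofTorusSite (x + Torus.proj L u)) 1); let φ : TorusSite 2 L → Fock (Orb (FermionTorus 2 L)) := fun x => ((A x e)ᴴ * A (x + r) e') *ᵥ ψ; 2 * ε * (∑ x : TorusSite 2 L, (star (φ x) ⬝ᵥ φ x).re) ≤ |∑ x : TorusSite 2 L,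 (star ψ ⬝ᵥ φ x).re| → 0 ≤ dWaveFormFactor e * dWaveFormFactor e' * (∑ x : TorusSite 2 L, (star ψ ⬝ᵥ φ x).re)) := by
  intro hA hB U hU δ hδ ε hε
  obtain ⟨R₁, L₁, hA⟩ := hA U hU δ hδ ε hε
  obtain ⟨R₂, L₂, hB⟩ := hB U hU δ hδ ε hε
  refine ⟨R₁ + R₂, L₁ + L₂, ?_⟩
  intro L _ hL hE ψ hψ hgs hb r hr e he e' he'
  set A : TorusSite 2 L → Site 2 → Matrix (Finset (Orb (FermionTorus 2 L))) (Finset (Orb (FermionTorus 2 L))) ℂ :=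
    fun x u => annihilation (orb (FermionTorus.ofTorusSite x) 0) *
      annihilation (orb (FermionTorus.ofTorusSite (x + Torus.proj L u)) 1) with hAdef
  set T : TorusSite 2 L → Matrix (Finset (Orb (FermionTorus 2 L))) (Finset (Orb (FermionTorus 2 L))) ℂ :=
    fun x => (A x e)ᴴ * A (x + r) e' with hTdef
  have hg : dWaveFormFactor e * dWaveFormFactor e' = 1 ∨ dWaveFormFactor e * dWaveFormFactor e' = -1 := by
    apply mul_self_eq_one_iff.1
    have h₁ := sq_dWaveFormFactor_eq_one he
    have h₂ := sq_dWaveFormFactor_eq_one he'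
    nlinarith
  show 2 * ε * (∑ x : TorusSite 2 L, (star (T x *ᵥ ψ) ⬝ᵥ (T x *ᵥ ψ)).re) ≤ |∑ x : TorusSite 2 L, (star ψ ⬝ᵥ (T x *ᵥ ψ)).re| →
    0 ≤ dWaveFormFactor e * dWaveFormFactor e' * ∑ x : TorusSite 2 L, (star ψ ⬝ᵥ (T x *ᵥ ψ)).re
  intro hQS
  rcases hg with hg1 | hg1
  · have hA' : 2 * ε * (∑ x : TorusSite 2 L, (star (T x *ᵥ ψ) ⬝ᵥ (T x *ᵥ ψ)).re) ≤ |∑ x : TorusSite 2 L, (star ψ ⬝ᵥ (T x *ᵥ ψ)).re| →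
        0 ≤ ∑ x : TorusSite 2 L, (star ψ ⬝ᵥ (T x *ᵥ ψ)).re :=
      hA L (by omega) hE ψ hψ hgs hb r (le_trans (by omega) hr) e he e' he' hg1
    rw [hg1, one_mul]
    exact hA' hQS
  · have hB' : 2 * ε * (∑ x : TorusSite 2 L, (star (T x *ᵥ ψ) ⬝ᵥ (T x *ᵥ ψ)).re) ≤ |∑ x : TorusSite 2 L, (star ψ ⬝ᵥ (T x *ᵥ ψ)).re| →
        ∑ x : TorusSite 2 L, (star ψ ⬝ᵥ (T x *ᵥ ψ)).re ≤ 0 :=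
      hB L (by omega) hE ψ hψ hgs hb r (le_trans (by omega) hr) e he e' he' hg1
    rw [hg1]
    have := hB' hQS
    linarith

/-- **The crux BY NAME from the two named stubs** (hypothesis-free form; its only `sorry`s are the
stubs'; the theorem `#h21_check_skeleton` registers — `DWaveChannelSelection_of` above has the BC3 shape with the crux
statement spelled out, so that it is not a by-name candidate). [folklore] -/
theorem DWaveChannelSelection_of_stubs : DWaveChannelSelection :=
  DWaveChannelSelection_of stub_parallelClassNonneg stub_perpendicularClassNonpos

end Summit.HubbardSuperconductivity.HubbardSuperconductivity.Cruxes.DWaveChannelSelection.Birth
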